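import Summits.AtomisticToContinuum.HydrodynamicLimit.Theorems.AntiMazurCoboundariesCellForecastPressureDecayPoissonCorrector
import HarnessLib

/-!
# Stub S1 `stub_poissonCorrector` of the line `enskog-compensator-martingale` — reduction to
# "bounded modulo collision invariants" (crux `CellForecastPressureDecay`, stmt-AtomisticToContinuum-13915)

S1 asks for a sup-norm-bounded continuous pre-image `w`, `L w = g`, of every bounded continuous
`g ⊥_M span{1, v, |v|²}` under the in-tree linearised hard-sphere operator `L = hardSphereLinearizedOp`
of `ℝ³`, with a uniform constant. The landed reduction `stub_poissonCorrector_of_exists`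
(`…PoissonCorrector.lean`, Banach open mapping) already removes the constant: SOME bounded measurable
pre-image for each such `g` suffices. The tree's pre-images (`exists_continuous_inverse_hardSphereLinearizedOp`
and its `_subGaussian` / `_quartic` sharpenings) are the `M`-ORTHOGONAL solution `ψ₀`, which is in general
unbounded (`exists_unbounded_orthogonal_inverse_hardSphereLinearizedOp`: it carries a non-trivial element
of `span{v, |v|²}`); the expected borderline theorem is the ASYMPTOTIC statement
`ψ₀ = c |v|² + ⟪e, v⟫ + a + O(1)` — i.e. `ψ₀` is bounded modulo `collisionInvariants V3`.

This file proves the purely algebraic bridge from that asymptotic form to S1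
(`stub_poissonCorrector_of_boundedModInvariants`, registered sub-goal): if every bounded continuous
`g ⊥_M` invariants has a measurable pre-image `ψ` which is bounded modulo SOME collision invariant `φ`,
then S1 holds verbatim — `w := ψ - φ` is bounded and `L (ψ - φ) = L ψ` pointwise
(`hardSphereLinearizedOp_sub_eq_of_mem_collisionInvariants`: the invariant is annihilated by `L`,
`linearizedCollisionOp_eq_zero_of_isCollisionInvariant`, and Grad's splitting `L = K - ν` is additive on
functions of Gaussian growth, `kernelAction_sub_of_gaussGrowth`; a function bounded modulo a quadratic
has Gaussian growth). So the line's blocker is EXACTLY: the `M`-orthogonal Chapman–Enskog inverse of a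
bounded `g ⊥` invariants is bounded modulo `span{1, v, |v|²}` (Kondrat'ev-type asymptotics at the
borderline Maxwellian weight; indicial roots `β = 2` (energy, `l = 0`) and `β = 1` (momentum, `l = 1`) of
`4 ∫₀¹ P_l(c) c^{β+1} dc = 1`, no root with `Re β ≥ 0` for `l ≥ 2`). No new definitions; the registered
stub `stub_poissonCorrector` itself stays open here.
-/

noncomputable section

open MeasureTheory ProbabilityTheory Set Filter
open scoped ENNReal BigOperators InnerProductSpace
open Literature.Analysis.FluidPDE Literature.MathematicalPhysics.KineticTheory
open Literature.Analysis.UnboundedOperators (hardSphereLinearizedOp collisionInvariants maxwellianInner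
  mem_collisionInvariants_iff hardSphereLinearizedOp_eq_kernel_sub_of_gaussGrowth
  kernelAction_sub_of_gaussGrowth linearizedCollisionOp_eq_zero_of_isCollisionInvariant)

namespace Summit.AtomisticToContinuum.HydrodynamicLimit.Theorems.EnskogCompensator

/-- **Gaussian growth of a quadratic collision invariant**:
`|a + ⟪b, x⟫ + c |x|²| ≤ (|a| + |b| + 4 |c|) e^{|x|²/4}` (from `|x| ≤ 1 + |x|²/4 ≤ e^{|x|²/4}`). [folklore] -/
theorem abs_quadratic_le_mul_exp (a c : ℝ) (b x : V3) :
    |a + ⟪b, x⟫_ℝ + c * ‖x‖ ^ 2| ≤ (|a| + ‖b‖ + 4 * |c|) * Real.exp (‖x‖ ^ 2 / 4) := by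
  have he : 1 + ‖x‖ ^ 2 / 4 ≤ Real.exp (‖x‖ ^ 2 / 4) := by
    linarith [Real.add_one_le_exp (‖x‖ ^ 2 / 4)]
  have h1 : (1 : ℝ) ≤ Real.exp (‖x‖ ^ 2 / 4) := Real.one_le_exp (by positivity)
  have hn : ‖x‖ ≤ Real.exp (‖x‖ ^ 2 / 4) := by nlinarith [sq_nonneg (‖x‖ - 2), norm_nonneg x]
  have hsq : ‖x‖ ^ 2 ≤ 4 * Real.exp (‖x‖ ^ 2 / 4) := by nlinarith [sq_nonneg ‖x‖]
  have hb : |⟪b, x⟫_ℝ| ≤ ‖b‖ * ‖x‖ := abs_real_inner_le_norm b x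
  calc |a + ⟪b, x⟫_ℝ + c * ‖x‖ ^ 2| ≤ |a| + |⟪b, x⟫_ℝ| + |c| * ‖x‖ ^ 2 := by
        refine (abs_add_le _ _).trans (add_le_add (abs_add_le _ _) ?_)
        rw [abs_mul, abs_of_nonneg (by positivity : (0 : ℝ) ≤ ‖x‖ ^ 2)]
    _ ≤ |a| * Real.exp (‖x‖ ^ 2 / 4) + ‖b‖ * Real.exp (‖x‖ ^ 2 / 4) +
          |c| * (4 * Real.exp (‖x‖ ^ 2 / 4)) := by
        refine add_le_add (add_le_add ?_ ?_) ?_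
        · exact le_mul_of_one_le_right (abs_nonneg _) h1
        · exact hb.trans (mul_le_mul_of_nonneg_left hn (norm_nonneg _))
        · exact mul_le_mul_of_nonneg_left hsq (abs_nonneg _)
    _ = (|a| + ‖b‖ + 4 * |c|) * Real.exp (‖x‖ ^ 2 / 4) := by ring

/-- A collision invariant `φ ∈ span{1, v, |v|²}` is continuous, hence measurable. [folklore] -/
theorem measurable_of_mem_collisionInvariants {φ : V3 → ℝ} (hφ : φ ∈ collisionInvariants V3) :
    Measurable φ := by
  obtain ⟨a, c, b, rfl⟩ := mem_collisionInvariants_iff.1 hφ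
  have : Continuous fun v : V3 => a + ⟪b, v⟫_ℝ + c * ‖v‖ ^ 2 := by fun_prop
  exact this.measurable

/-- **`L (ψ - φ) = L ψ` at every velocity** for a collision invariant `φ ∈ span{1, v, |v|²}` and a
measurable `ψ` bounded modulo `φ`: the invariant is annihilated by `L`
(`linearizedCollisionOp_eq_zero_of_isCollisionInvariant`), `ψ = (ψ - φ) + φ` has Gaussian growth, and Grad's
splitting `L = K - ν` is additive on measurable functions of Gaussian growth
(`kernelAction_sub_of_gaussGrowth`, `hardSphereLinearizedOp_eq_kernel_sub_of_gaussGrowth`). [folklore] -/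
theorem hardSphereLinearizedOp_sub_eq_of_mem_collisionInvariants {ψ φ : V3 → ℝ} (hψ : Measurable ψ)
    (hφ : φ ∈ collisionInvariants V3) {B : ℝ} (hB : ∀ v, |ψ v - φ v| ≤ B) (v : V3) :
    hardSphereLinearizedOp (ψ - φ) v = hardSphereLinearizedOp ψ v := by
  have hφm : Measurable φ := measurable_of_mem_collisionInvariants hφ
  obtain ⟨a, c, b, rfl⟩ := mem_collisionInvariants_iff.1 hφ
  have hB0 : 0 ≤ B := (abs_nonneg _).trans (hB 0)
  have hφC : ∀ x : V3, |(fun v : V3 => a + ⟪b, v⟫_ℝ + c * ‖v‖ ^ 2) x| ≤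
      (|a| + ‖b‖ + 4 * |c|) * Real.exp (‖x‖ ^ 2 / 4) := fun x => abs_quadratic_le_mul_exp a c b x
  have hdiffC : ∀ x : V3, |(ψ - fun v : V3 => a + ⟪b, v⟫_ℝ + c * ‖v‖ ^ 2) x| ≤
      B * Real.exp (‖x‖ ^ 2 / 4) := fun x => by
    rw [Pi.sub_apply]
    exact (hB x).trans (le_mul_of_one_le_right hB0 (Real.one_le_exp (by positivity)))
  have hψC : ∀ x : V3, |ψ x| ≤ (B + (|a| + ‖b‖ + 4 * |c|)) * Real.exp (‖x‖ ^ 2 / 4) := fun x => by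
    have h1 := hdiffC x
    have h2 := hφC x
    rw [Pi.sub_apply] at h1
    have : ψ x = (ψ x - (a + ⟪b, x⟫_ℝ + c * ‖x‖ ^ 2)) + (a + ⟪b, x⟫_ℝ + c * ‖x‖ ^ 2) := by ring
    rw [this, add_mul]
    exact (abs_add_le _ _).trans (add_le_add h1 h2)
  -- the invariant is annihilated by `L`, with absolutely convergent splitting
  have hinv : IsCollisionInvariant fun v : V3 => a + ⟪b, v⟫_ℝ + c * ‖v‖ ^ 2 :=
    isCollisionInvariant_quadratic a c b
  have hL0 : hardSphereLinearizedOp (fun v : V3 => a + ⟪b, v⟫_ℝ + c * ‖v‖ ^ 2) v = 0 := by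
    have := linearizedCollisionOp_eq_zero_of_isCollisionInvariant (E := V3) hardSphereKernel hinv
    exact congrFun this v
  have e1 := hardSphereLinearizedOp_eq_kernel_sub_of_gaussGrowth (hψ.sub hφm) hdiffC v
  have e2 := hardSphereLinearizedOp_eq_kernel_sub_of_gaussGrowth hψ hψC v
  have e3 := hardSphereLinearizedOp_eq_kernel_sub_of_gaussGrowth hφm hφC v
  have hsub := kernelAction_sub_of_gaussGrowth hψ hφm hψC hφC v
  rw [e1, hsub, e2]
  rw [hL0] at e3
  simp only [Pi.sub_apply]
  linarith

/-- **Registered sub-goal `stub_poissonCorrector_of_boundedModInvariants` of S1** (line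
`enskog-compensator-martingale`, crux stmt-AtomisticToContinuum-13915). If every bounded continuous
`g ⊥_M span{1, v, |v|²}` has a measurable pre-image `ψ` under the linearised hard-sphere operator,
`L ψ = g` pointwise, which is **bounded modulo some collision invariant** `φ ∈ span{1, v, |v|²}`
(`|ψ - φ| ≤ B`; this is the expected asymptotic form `ψ₀ = c|v|² + ⟪e, v⟫ + a + O(1)` of the tree's
`M`-orthogonal Chapman–Enskog inverse at the borderline Maxwellian weight), then S1 holds verbatim with a
UNIFORM constant: `w := ψ - φ` is a bounded measurable pre-image
(`hardSphereLinearizedOp_sub_eq_of_mem_collisionInvariants`), and `stub_poissonCorrector_of_exists`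
(automatic continuity + Banach's open mapping theorem) supplies the constant. [folklore] -/
theorem stub_poissonCorrector_of_boundedModInvariants :
    (∀ (g : V3 → ℝ) (b : ℝ), Continuous g → (∀ v, |g v| ≤ b) →
      (∀ φ ∈ collisionInvariants V3, maxwellianInner g φ = 0) →
      ∃ ψ : V3 → ℝ, Measurable ψ ∧ (∃ φ ∈ collisionInvariants V3, ∃ B : ℝ, ∀ v, |ψ v - φ v| ≤ B) ∧
        ∀ v, hardSphereLinearizedOp ψ v = g v) →
    ∃ C₀ : ℝ, 0 < C₀ ∧ ∀ (g : V3 → ℝ) (b : ℝ), Continuous g → (∀ v, |g v| ≤ b) → Orthogonal g →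
      ∃ w : V3 → ℝ, Continuous w ∧ (∀ v, |w v| ≤ C₀ * b) ∧ hardSphereLinearizedOp w = g := by
  intro H
  refine stub_poissonCorrector_of_exists fun g b hg hb horth => ?_
  obtain ⟨ψ, hψm, ⟨φ, hφ, B, hB⟩, hL⟩ := H g b hg hb horth
  refine ⟨ψ - φ, hψm.sub (measurable_of_mem_collisionInvariants hφ), ⟨B, fun v => ?_⟩, fun v => ?_⟩
  · rw [Pi.sub_apply]; exact hB v
  · rw [hardSphereLinearizedOp_sub_eq_of_mem_collisionInvariants hψm hφ hB v, hL v]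

end Summit.AtomisticToContinuum.HydrodynamicLimit.Theorems.EnskogCompensator

end
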